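import Summits.ResolutionOfSingularities.ResolutionOfSingularities.Theorems.PurelyInseparableDim4ResConeAdjoin
import Summits.ResolutionOfSingularities.ResolutionOfSingularities.Theorems.PurelyInseparableDim4ResConePowerConeAlgClosed
import Literature.RingTheory.MvPolynomial.BinaryFormLinearFactors
import Mathlib.Algebra.Polynomial.Homogenize
import Mathlib.Algebra.Polynomial.Splits
import Mathlib.FieldTheory.IsAlgClosed.Basic
import HarnessLib

/-!
# Purely inseparable four-folds — AT `e_G = 2` OVER AN ALGEBRAICALLY CLOSED FIELD THE RESIDUAL CONE IS A
# PRODUCT OF `d` LINEAR FORMS (cell `res-dim4-pi`, K2(p) lane, slice C «binary cones»)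

[OURS · counted 0 · AI work weaker than expert review.]  Cell `res-dim4-pi` (D-0157 DOOR 2), seat `res-dim4-p-3` g3
(free hand of the K2(p) lane; companion of `…ResConeSlicesAlgClosed`: slices may be emptied over algebraically
closed fields; `…ResConePowerConeAlgClosed` is the `e_G = 3` twin).  NOTHING here proves K2(p),
`NoIsolatedTrap p p` or resolution of singularities in dimension ≥ 4 / characteristic `p`.

Slice C of K2(p) (res-dim4-p-12 g2 `…ResConeAdjoin`, res-dim4-p-5 lineage): at `e_G = 2` the residual cone is a
BINARY FORM `B(ℓ₁, ℓ₂)` of degree `d < p` in two linear forms; the slice-C plan (p-5 g3, (C3)/(C5)) tracks its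
«root pattern».  Over an algebraically closed field that pattern is a multiset of `d` points of `ℙ¹` and the cone
is the corresponding product of linear forms:
* §1 (namespace `BinaryForm`, pure algebra) `homogenize_multiset_prod_X_sub_C`;
  **`eq_C_mul_X_pow_mul_prod_roots`** — over an ALGEBRAICALLY CLOSED field a binary form `q ∈ K[X₀, X₁]` of
  degree `n` EQUALS `C (lc p) · X₁^{n − deg p} · ∏_{a ∈ roots p} (X₀ − a·X₁)`, `p = q(X, 1)` (the ROOT PATTERN
  as data: roots with multiplicity plus the multiplicity `n − deg p` of `(1 : 0)`; Mathlib's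
  `Polynomial.homogenize_eq_of_isHomogeneous` + `IsAlgClosed.splits`); `rootPattern_card`,
  `eq_C_mul_X_pow_mul_prod_of_isHomogeneous` (existential packaging, `c ≠ 0`, `m + |s| = n`).  The cruder
  `∏ (uᵢ X₀ + vᵢ X₁)` shape is the tree's `Literature.RingTheory.MvPolynomial.exists_C_mul_prod_linear_of_isHomogeneous`
  (Gibson 1998, Lemma 3.14), whose `natDegree_aeval_X_one_le` we reuse.
* §2 `ResCone.exists_isHomogeneous_aeval_eq_of_ker_le` — HOMOGENEOUS-PREIMAGE sharpening of p-12 g2's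
  `ResCone.mem_adjoin_of_ker_le`: a tame form (`d < p`) whose polar map kills the common kernel of a dual family
  `φ` is `q(L_φ)` for a form `q` of the SAME degree in `4 − e_G` letters.
* §3 `ResCone.resForm_eq_aeval_binaryForm_of_finrank_eq_two` (any field: at `e_G = 2` the residual cone is a
  binary form of degree `d` in two linear forms with a dual pair) and
  **`ResCone.resForm_eq_prod_linear_of_finrank_eq_two`** (algebraically closed field:
  `resForm s = C c · L₁^m · ∏_{a ∈ t} (L₀ − a·L₁)`, `c ≠ 0`, `m + |t| = d` — a product of `d` non-zero
  linear forms vanishing on `resVertex s`).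
bears_on: LADDER-RESOLUTION:D157-DOOR2 (res-dim4-pi · K2(p) · slice C).  Supports
stmt-ResolutionOfSingularities-16155 (helper).
-/

set_option linter.dupNamespace false -- mandated namespace of this single-conjunct summit

noncomputable section

namespace Summit.ResolutionOfSingularities.ResolutionOfSingularities.Theorems.PIDim4

namespace BinaryForm

open Polynomial

variable {K : Type} [Field K]

/-! ## 1. Binary forms: the root pattern over an algebraically closed field -/

/-- `Polynomial.homogenize (∏_{a ∈ s} (X − a)) |s| = ∏_{a ∈ s} (X₀ − a X₁)`. [folklore] -/
theorem homogenize_multiset_prod_X_sub_C (s : Multiset K) :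
    ((s.map fun a => (X - C a : K[X])).prod).homogenize (Multiset.card s) =
      (s.map fun a => (MvPolynomial.X 0 - MvPolynomial.C a * MvPolynomial.X 1 :
        MvPolynomial (Fin 2) K)).prod := by
  induction s using Multiset.induction_on with
  | empty => simp [Polynomial.homogenize_one]
  | cons a s ih =>
    rw [Multiset.map_cons, Multiset.prod_cons, Multiset.card_cons, Multiset.map_cons, Multiset.prod_cons,
      add_comm, Polynomial.homogenize_mul _ _ (natDegree_X_sub_C_le (r := a))
        (le_of_eq (natDegree_multiset_prod_X_sub_C_eq_card s)), ih,
      Polynomial.homogenize_sub, Polynomial.homogenize_X one_ne_zero, Polynomial.homogenize_C]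
    simp

/-- **THE ROOT PATTERN OF A BINARY FORM OVER AN ALGEBRAICALLY CLOSED FIELD** (explicit form of Gibson's
Lemma 3.14, whose `∏ (uᵢ X₀ + vᵢ X₁)` shape is the tree's
`Literature.RingTheory.MvPolynomial.exists_C_mul_prod_linear_of_isHomogeneous`): a binary form `q ∈ K[X₀, X₁]`
homogeneous of degree `n` EQUALS `C (lc p) · X₁^{n − deg p} · ∏_{a ∈ roots p} (X₀ − a·X₁)`, where
`p = q(X, 1)` is its dehomogenisation (roots with multiplicity; `n − deg p` = the multiplicity of the root at
infinity `(1 : 0)`; `q = 0` allowed, then `lc p = 0`). [cite: Gibson1998, Lemma 3.14] -/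
theorem eq_C_mul_X_pow_mul_prod_roots [IsAlgClosed K] {q : MvPolynomial (Fin 2) K} {n : ℕ}
    (hq : q.IsHomogeneous n) :
    q = MvPolynomial.C (MvPolynomial.aeval ![(X : K[X]), 1] q).leadingCoeff *
      MvPolynomial.X 1 ^ (n - (MvPolynomial.aeval ![(X : K[X]), 1] q).natDegree) *
        ((MvPolynomial.aeval ![(X : K[X]), 1] q).roots.map fun a =>
          (MvPolynomial.X 0 - MvPolynomial.C a * MvPolynomial.X 1 : MvPolynomial (Fin 2) K)).prod := by
  set p : K[X] := MvPolynomial.aeval ![(X : K[X]), 1] q with hp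
  have hhom : p.homogenize n = q := Polynomial.homogenize_eq_of_isHomogeneous hq rfl
  have hdeg : p.natDegree ≤ n := Literature.RingTheory.MvPolynomial.natDegree_aeval_X_one_le hq
  have hsplit : p.Splits := IsAlgClosed.splits p
  have hprod := hsplit.eq_prod_roots
  have hcard : p.roots.card = p.natDegree := splits_iff_card_roots.mp hsplit
  have key : (C p.leadingCoeff * (p.roots.map fun a => (X - C a : K[X])).prod).homogenize
      ((n - p.natDegree) + Multiset.card p.roots) =
      MvPolynomial.C p.leadingCoeff * MvPolynomial.X 1 ^ (n - p.natDegree) *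
        (p.roots.map fun a => (MvPolynomial.X 0 - MvPolynomial.C a * MvPolynomial.X 1 :
          MvPolynomial (Fin 2) K)).prod := by
    rw [Polynomial.homogenize_mul _ _ (by rw [natDegree_C]; exact Nat.zero_le _)
      (le_of_eq (natDegree_multiset_prod_X_sub_C_eq_card p.roots)), Polynomial.homogenize_C,
      homogenize_multiset_prod_X_sub_C]
  calc q = p.homogenize n := hhom.symm
    _ = (C p.leadingCoeff * (p.roots.map fun a => (X - C a : K[X])).prod).homogenize
          ((n - p.natDegree) + Multiset.card p.roots) := by
        rw [← hprod]
        congr 1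
        omega
    _ = _ := key

/-- The root pattern has total multiplicity `n`: for a NON-ZERO binary form of degree `n`,
`(n − deg p) + |roots p| = n` and `lc p ≠ 0`, `p = q(X, 1)`. [cite: Gibson1998, Lemma 3.14] -/
theorem rootPattern_card [IsAlgClosed K] {q : MvPolynomial (Fin 2) K} {n : ℕ} (hq : q.IsHomogeneous n)
    (hq0 : q ≠ 0) :
    (MvPolynomial.aeval ![(X : K[X]), 1] q).leadingCoeff ≠ 0 ∧
      (n - (MvPolynomial.aeval ![(X : K[X]), 1] q).natDegree) +
        Multiset.card (MvPolynomial.aeval ![(X : K[X]), 1] q).roots = n := by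
  set p : K[X] := MvPolynomial.aeval ![(X : K[X]), 1] q with hp
  have hhom : p.homogenize n = q := Polynomial.homogenize_eq_of_isHomogeneous hq rfl
  have hp0 : p ≠ 0 := by
    intro h
    apply hq0
    rw [← hhom, h, Polynomial.homogenize_zero]
  have hdeg : p.natDegree ≤ n := Literature.RingTheory.MvPolynomial.natDegree_aeval_X_one_le hq
  have hcard : p.roots.card = p.natDegree := splits_iff_card_roots.mp (IsAlgClosed.splits p)
  exact ⟨leadingCoeff_ne_zero.mpr hp0, by omega⟩

/-- **BINARY FORMS SPLIT OVER AN ALGEBRAICALLY CLOSED FIELD, WITH THE ROOT PATTERN AS DATA**: every non-zero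
binary form `q ∈ K[X₀, X₁]` of degree `n` is `C c · X₁^m · ∏_{a ∈ s} (X₀ − a·X₁)` with `c ≠ 0` and
`m + |s| = n` (`s` = the roots of `q(X, 1)` with multiplicity, `m` = the multiplicity of `(1 : 0)`).
[cite: Gibson1998, Lemma 3.14] -/
theorem eq_C_mul_X_pow_mul_prod_of_isHomogeneous [IsAlgClosed K] {q : MvPolynomial (Fin 2) K} {n : ℕ}
    (hq : q.IsHomogeneous n) (hq0 : q ≠ 0) :
    ∃ (c : K) (m : ℕ) (s : Multiset K), c ≠ 0 ∧ m + Multiset.card s = n ∧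
      q = MvPolynomial.C c * MvPolynomial.X 1 ^ m *
        (s.map fun a => (MvPolynomial.X 0 - MvPolynomial.C a * MvPolynomial.X 1 :
          MvPolynomial (Fin 2) K)).prod :=
  ⟨_, _, _, (rootPattern_card hq hq0).1, (rootPattern_card hq hq0).2, eq_C_mul_X_pow_mul_prod_roots hq⟩

end BinaryForm

namespace ResCone

open MvPolynomial Finset
open Literature.AlgebraicGeometry.Resolution
open Literature.AlgebraicGeometry.Resolution.CentreBlowup
open Literature.AlgebraicGeometry.Resolution.Hauser2010
open Literature.AlgebraicGeometry.Resolution.HauserPerlega2019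
open PointBlowup (polarMap additiveSubspace)

variable {K : Type} [Field K]

/-! ## 2. A tame form is a FORM in the linear forms cutting out its polar kernel -/

section Dual

variable {ι : Type} [Fintype ι] [DecidableEq ι]

/-- **Homogeneous preimage** (sharpening res-dim4-p-12 g2's `mem_adjoin_of_ker_le`): if `deg g = d < p` and
`D_w g = 0` on the common kernel of `φ₁, …, φ_n` (with a dual family `u`), then `g = q(L₁, …, L_n)` for a form
`q ∈ K[Y₁, …, Y_n]` HOMOGENEOUS OF THE SAME DEGREE `d`, `L_a = Σ_i φ_a(e_i) x_i`.  Induction on `d` with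
Euler's identity, as in `…ResConeAdjoin`. [folklore] [cite: CossartJannsenSaito2020, Def. 2.8 (directrix of a cone)] -/
theorem exists_isHomogeneous_aeval_eq_of_ker_le (p : ℕ) [Fact p.Prime] [CharP K p]
    (φ : ι → (Fin 4 → K) →ₗ[K] K) (u : ι → Fin 4 → K) (hdual : ∀ a b, φ a (u b) = if b = a then 1 else 0) :
    ∀ (d : ℕ), d < p → ∀ g : MvPolynomial (Fin 4) K, g.IsHomogeneous d →
      (∀ w : Fin 4 → K, (∀ a, φ a w = 0) → polarMap g w = 0) →
      ∃ q : MvPolynomial ι K, q.IsHomogeneous d ∧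
        aeval (fun a : ι => ∑ i : Fin 4, C (φ a (Pi.single i 1)) * (X i : MvPolynomial (Fin 4) K)) q = g := by
  intro d
  induction d with
  | zero =>
    intro _ g hg _
    refine ⟨C (coeff 0 g), isHomogeneous_C _ _, ?_⟩
    rw [aeval_C, algebraMap_eq]
    exact (totalDegree_eq_zero_iff_eq_C.mp ((totalDegree_zero_iff_isHomogeneous _).mpr hg)).symm
  | succ d ih =>
    intro hdp g hg hker
    -- the polars `D_{u_a} g`: forms of degree `d` with the same kernel condition
    have hh : ∀ a, (polarMap g (u a)).IsHomogeneous d := fun a => by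
      rw [polarMap_eq_sum_C_mul]
      simpa using CampaignW46.TameDirectrix.isHomogeneous_dirDeriv hg (u a)
    have hkh : ∀ a, ∀ w : Fin 4 → K, (∀ b, φ b w = 0) → polarMap (polarMap g (u a)) w = 0 :=
      fun a w hw => by rw [polarMap_polarMap_comm, hker w hw, polarMap_zero_left]
    choose q hq using fun a => ih (by omega) _ (hh a) (hkh a)
    -- partials and Euler
    have hpd : ∀ i, pderiv i g = ∑ a, φ a (Pi.single i 1) • polarMap g (u a) := fun i => by
      rw [← polarMap_single, polarMap_eq_sum_of_dual φ u hdual hker]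
    have heuler := hg.sum_X_mul_pderiv
    have hsum : ∑ i : Fin 4, X i * pderiv i g =
        ∑ a, (∑ i : Fin 4, C (φ a (Pi.single i 1)) * X i) * polarMap g (u a) := by
      simp_rw [hpd, Finset.mul_sum, Finset.sum_mul]
      rw [Finset.sum_comm]
      refine Finset.sum_congr rfl fun a _ => Finset.sum_congr rfl fun i _ => ?_
      rw [← MvPolynomial.C_mul']
      ring
    have hn : ((d + 1 : ℕ) : K) ≠ 0 := natCast_ne_zero_of_lt p (Nat.succ_pos d) hdp
    have hg' : g = C (((d + 1 : ℕ) : K)⁻¹) *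
        ∑ a, (∑ i : Fin 4, C (φ a (Pi.single i 1)) * X i) * polarMap g (u a) := by
      rw [← hsum, heuler, ← smul_eq_C_mul, ← Nat.cast_smul_eq_nsmul K, inv_smul_smul₀ hn]
    refine ⟨C (((d + 1 : ℕ) : K)⁻¹) * ∑ a, X a * q a, ?_, ?_⟩
    · refine IsHomogeneous.C_mul (IsHomogeneous.sum _ _ _ fun a _ => ?_) _
      rw [add_comm]
      exact (isHomogeneous_X K a).mul (hq a).1
    · rw [map_mul, aeval_C, algebraMap_eq, map_sum, hg']
      congr 1
      exact Finset.sum_congr rfl fun a _ => by rw [map_mul, aeval_X, (hq a).2]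

end Dual

/-! ## 3. At `e_G = 2` over an algebraically closed field the residual cone is a product of linear forms -/

/-- **THE `e_G = 2` RESIDUAL CONE IS A BINARY FORM OF THE SAME DEGREE** (tame range, any field): for a state
with `ord₀ F = o`, shade `d = o − |r| < p` and polar-kernel rank `2` there are two linear functionals `φ₀, φ₁`
with a dual pair `u₀, u₁` (`φ_a(u_b) = δ_{ab}`) cutting out `resVertex s`, and a binary form `q ∈ K[Y₀, Y₁]`
homogeneous of degree `d` with `resForm s = q(L₀, L₁)`, `L_a = Σ_i φ_a(e_i) x_i`.
[OURS] [cite: CossartJannsenSaito2020, Def. 2.8 (directrix of a cone)] -/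
theorem resForm_eq_aeval_binaryForm_of_finrank_eq_two (p : ℕ) [Fact p.Prime] [CharP K p] {s : State K}
    {o : ℕ} (ho : ordZero s.F = o) (hd : o - s.r.degree < p)
    (he : Module.finrank K (resVertex s) = 2) :
    ∃ (φ : Fin 2 → (Fin 4 → K) →ₗ[K] K) (u : Fin 2 → Fin 4 → K) (q : MvPolynomial (Fin 2) K),
      (∀ a b, φ a (u b) = if b = a then 1 else 0) ∧
      (∀ w, w ∈ resVertex s ↔ ∀ a, φ a w = 0) ∧
      q.IsHomogeneous (o - s.r.degree) ∧
      aeval (fun a : Fin 2 => ∑ i : Fin 4, C (φ a (Pi.single i 1)) * (X i : MvPolynomial (Fin 4) K)) q =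
        resForm s := by
  classical
  obtain ⟨W', hc⟩ := Submodule.exists_isCompl (resVertex s)
  have hW' : Module.finrank K W' = 2 := by
    have h := Submodule.finrank_add_eq_of_isCompl hc
    rw [Module.finrank_fin_fun, he] at h
    omega
  let b := Module.finBasisOfFinrankEq K W' hW'
  let π := Submodule.projectionOnto W' (resVertex s) hc.symm
  have hiff : ∀ w, w ∈ resVertex s ↔ ∀ a, ((b.coord a) ∘ₗ π) w = 0 := by
    intro w
    constructor
    · intro hw a
      rw [LinearMap.comp_apply, (Submodule.projectionOnto_apply_eq_zero_iff hc.symm).mpr hw, map_zero]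
    · intro h
      have hπ : π w = 0 :=
        b.forall_coord_eq_zero_iff.mp fun a => by simpa only [LinearMap.comp_apply] using h a
      exact (Submodule.projectionOnto_apply_eq_zero_iff hc.symm).mp hπ
  have hdual : ∀ a c, ((b.coord a) ∘ₗ π) ((b c : W') : Fin 4 → K) = if c = a then 1 else 0 := by
    intro a c
    rw [LinearMap.comp_apply, Submodule.projectionOnto_apply_left, b.coord_apply, b.repr_self_apply]
  have hker : ∀ w : Fin 4 → K, (∀ a, ((b.coord a) ∘ₗ π) w = 0) → polarMap (resForm s) w = 0 := by
    intro w hw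
    have hmemw : w ∈ resVertex s := (hiff w).mpr hw
    unfold resVertex additiveSubspace at hmemw
    exact LinearMap.mem_ker.mp hmemw
  obtain ⟨q, hq, hqe⟩ := exists_isHomogeneous_aeval_eq_of_ker_le p (fun a => (b.coord a) ∘ₗ π)
    (fun a => (b a : Fin 4 → K)) hdual _ hd _ (resForm_isHomogeneous ho) hker
  exact ⟨fun a => (b.coord a) ∘ₗ π, fun a => (b a : Fin 4 → K), q, hdual, hiff, hq, hqe⟩

/-- **BINARY CONES SPLIT OVER AN ALGEBRAICALLY CLOSED FIELD** (tame range `d < p`, `e_G = 2`): over an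
algebraically closed field the residual cone of a state with `ord₀ F = o`, shade `d = o − |r| < p` and
polar-kernel rank `2` is
`resForm s = C c · L₁^m · ∏_{a ∈ t} (L₀ − a·L₁)`, `c ≠ 0`, `m + |t| = d`,
for two linear forms `L_a = Σ_i φ_a(e_i) x_i` with a dual pair, cutting out `resVertex s` — a product of `d`
NON-ZERO linear forms each vanishing on the polar kernel; `t` (with multiplicity) and `m` are the ROOT PATTERN
of the binary cone on `ℙ¹`. [OURS] [cite: CossartJannsenSaito2020, Def. 2.8 (directrix of a cone)] -/
theorem resForm_eq_prod_linear_of_finrank_eq_two (p : ℕ) [Fact p.Prime] [CharP K p] [IsAlgClosed K]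
    {s : State K} {o : ℕ} (ho : ordZero s.F = o) (hd : o - s.r.degree < p)
    (he : Module.finrank K (resVertex s) = 2) :
    ∃ (φ : Fin 2 → (Fin 4 → K) →ₗ[K] K) (u : Fin 2 → Fin 4 → K) (c : K) (m : ℕ) (t : Multiset K),
      (∀ a b, φ a (u b) = if b = a then 1 else 0) ∧
      (∀ w, w ∈ resVertex s ↔ ∀ a, φ a w = 0) ∧
      c ≠ 0 ∧ m + Multiset.card t = o - s.r.degree ∧
      resForm s = C c *
        (∑ i : Fin 4, C (φ 1 (Pi.single i 1)) * (X i : MvPolynomial (Fin 4) K)) ^ m *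
        (t.map fun a => (∑ i : Fin 4, C (φ 0 (Pi.single i 1)) * (X i : MvPolynomial (Fin 4) K)) -
          C a * (∑ i : Fin 4, C (φ 1 (Pi.single i 1)) * (X i : MvPolynomial (Fin 4) K))).prod := by
  obtain ⟨φ, u, q, hdual, hiff, hq, hqe⟩ := resForm_eq_aeval_binaryForm_of_finrank_eq_two p ho hd he
  have hq0 : q ≠ 0 := by
    intro h0
    rw [h0, map_zero] at hqe
    have h4 := finrank_resVertex_eq_four_of_resForm_eq_C (s := s) (a := 0) (by rw [C_0]; exact hqe.symm)
    omega
  obtain ⟨c, m, t, hc0, hmt, hq'⟩ := BinaryForm.eq_C_mul_X_pow_mul_prod_of_isHomogeneous hq hq0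
  refine ⟨φ, u, c, m, t, hdual, hiff, hc0, hmt, ?_⟩
  rw [← hqe, hq', map_mul, map_mul, map_pow, aeval_C, algebraMap_eq, aeval_X, map_multiset_prod,
    Multiset.map_map]
  congr 1
  refine congr_arg _ (Multiset.map_congr rfl fun a _ => ?_)
  rw [Function.comp_apply, map_sub, map_mul, aeval_C, algebraMap_eq, aeval_X, aeval_X]

end ResCone

end Summit.ResolutionOfSingularities.ResolutionOfSingularities.Theorems.PIDim4

end
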